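import Summits.CriticalPhenomena.PercolationContinuityZ3.Theorems.PercNearOneGluingNoHeavyConstsChainRuleLocalPeel
import HarnessLib
import HarnessLib.Audit.Tags

/-!
# The chain minor peeled at an avoided vertex PENDANT AT AN ARBITRARY VERTEX: the one-edge Bernstein form, and the
# set-target `D₀`-type inequality (PAPER-2 track (ii): constants of the CSH family)

builds on p205010 (kernel theorem, internal audit signed; external expert review pending).  Support file (`--supports
stmt-CriticalPhenomena-4575`), seat `prim-consts-2` (gen 8); rows A6/A11 of `run/shared/lean/prim/consts/CONSTANTS.md`; memo
`run/shared/lean/prim/consts/FROM-prim-consts-2-g8-STAR-PEEL.md`.  No definitions, no named facts, no sorries; standard axioms.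

Notation `K(S,T) = μ{S ↮ T}`; `D(G;Y) = det[[K(x,Y),K(x,Yo),K(x,Yov)],[K(xu,Y),K(xu,Yo),K(xu,Yov)],[K(xuv,Y),K(xuv,Yo),0]]` is the CHAIN
MINOR of `Consts.singleEdgeChainRule_of_chainMinor` (p306944: `D ≥ 0` everywhere ⟹ `Consts.SingleEdgeChainRule`).  The local family
(p309802) settles every avoided vertex attached only to `x,u,v,o`.  Here the avoided vertex `y` is PENDANT AT AN ARBITRARY VERTEX `z`
(weight `q = w(s(y,z))`, all other pairs at `y` of weight `0`): peeling the one pair (`Consts.avoidSdiff_pivot'`, then dropping the a.s.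
isolated `y`, `Consts.real_avoid_insert_of_isolated`) gives, with `k` the kernel of the weight vector switched off at `s(y,z)`,

* `Consts.real_avoid_insert_pendant` — `K(S, T₀ ∪ {y}) = q · k(S, T₀ ∪ {z}) + (1 − q) · k(S, T₀)` (`y ∉ S ∪ T₀`);
* `Consts.chainMinor_pendant_eq` — **the one-edge Bernstein form** `D(G;{y}) = (1−q)³·D₀ + q(1−q)²·M₁ + q²(1−q)·M₂ + q³·D(G⁰;{z})`,
  where `D₀ = det[[1,k(x,o),k(x,ov)],[1,k(xu,o),k(xu,ov)],[1,k(xuv,o),0]]` (PROVED, p305568), `D(G⁰;{z})` is the chain minor for the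
  avoided vertex `z` itself, and `M₁ = d₁ + d₂ + d₃`, `M₂ = d₁₂ + d₁₃ + d₂₃` are the sums of the determinants `d_J` obtained from `D₀`
  by adjoining `z` to the targets of the columns `j ∈ J` ("the spoiler `z` sent to one, resp. two, of the three columns").
  `M₁, M₂ ≥ 0` are AVOIDED-SET-FREE five-point inequalities (no conditioning common to the three rows); they are the two mixed
  Bernstein coefficients of the pendant edge, i.e. the `Y`-edge instance of `Consts.ChainRuleEdgeBernstein`-type positivity for `D`;
  exact numerics: `0` violations and nonnegative three-copy coefficient tables in all sampled instances `n ≤ 7` (memo §3), OPEN.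
* `Consts.chainMinor_midSetTarget_noAvoid` — **THEOREM (the piece `d₂`, and `d₂₃`, and `D₀` itself): for target SETS `O ⊆ O'`,
  `0 ≤ det[[1,K(x,O'),K(x,O∪v)],[1,K(xu,O'),K(xu,O∪v)],[1,K(xuv,O'),0]] = K(xu,Ov)·[K(x,O') − K(xuv,O')] − K(x,Ov)·[K(xu,O') − K(xuv,O')]`.**
  Proof: van den Berg–Häggström–Kahn Thm 1.3 for the source SET `O' ∪ {v}` given `O' ∪ {v} ↮ x` (`{v ↔ O'}` increasing,
  `{u ∉ C_{O'∪v}}` decreasing: `Consts.real_avoid_conn_notConn_mul_le`), the containment `{v ↔ O', O'∪v ↮ x} ⊆ {x ↮ O'} ∖ {xuv ↮ O'}`,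
  and reverse regularity `K(x,Ov)K(xu,O'v) ≤ K(x,O'v)K(xu,Ov)` (`Consts.disconnect_rr2`).  `O = O' = {o}` is `D₀`; `O = {o}`, `O' = {o,z}`
  is `d₂ ≥ 0`; `O = O' = {o,z}` is `d₂₃ ≥ 0`.
* `Consts.chainMinor_pendant_nonneg_of` — COROLLARY: `M₁ ≥ 0`, `M₂ ≥ 0` and `D(G⁰;{z}) ≥ 0` imply `D(G;{y}) ≥ 0`.
[cite: VandenbergHaggstromKahn2005, Thm. 1.1 (pp. 3–5), Thm. 1.3 (p. 6), Remark 1 after Thm. 1.2 (p. 5)] [cite: Grimmett1999, §2.2]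
-/

noncomputable section

namespace Summit.CriticalPhenomena.PercolationContinuityZ3.Theorems

open MeasureTheory Set Literature.Probability.LatticeModels Literature.Probability.Percolation
open scoped Classical

namespace Consts

/-- Notation (this file only): the disconnection kernel `𝕂[w](S, T) = μ_w{S ↮ T}`. -/
local notation3 "𝕂[" w "](" S ", " T ")" =>
  MeasureTheory.Measure.real (prodBernoulli w) {ω | ∀ s ∈ S, ∀ t ∈ T, ¬ (openGraph ω).Reachable s t}

/-- Notation (this file only): disconnection read in the configuration with the pairs `F` deleted. -/
local notation3 "𝔸[" w "](" F ", " S ", " T ")" =>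
  MeasureTheory.Measure.real (prodBernoulli w) {ω : BondConfig _ | ∀ s ∈ S, ∀ t ∈ T, ¬ (openGraph (ω \ F)).Reachable s t}

variable {V : Type*} [Fintype V]

/-- **Peel of one entry at a pendant avoided vertex.**  If every pair at `y` other than `s(y,z)` has weight `0` and `y ∉ S`,
then `K_w(S, T₀ ∪ {y}) = w(yz) · K_{w⁰}(S, T₀ ∪ {z}) + (1 − w(yz)) · K_{w⁰}(S, T₀)`, `w⁰ = w` switched off at `s(y,z)`
(condition on the pair; with it open, avoiding `y` means avoiding `z`; afterwards `y` is a.s. isolated and is dropped).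
[cite: VandenbergHaggstromKahn2005, Thm. 1.1 proof (pp. 4–5)] -/
theorem real_avoid_insert_pendant (w : Sym2 V → unitInterval) (S T₀ : Set V) {y z : V} (hyz : y ≠ z) (hyS : y ∉ S)
    (hpend : ∀ t, t ≠ y → t ≠ z → w s(y, t) = 0) (F : Set (Sym2 V)) (hF : F = {s(y, z)}) :
    𝕂[w](S, insert y T₀) =
      (w s(y, z) : ℝ) * 𝕂[fun e => if e ∈ F then 0 else w e](S, insert z T₀) +
        (1 - (w s(y, z) : ℝ)) * 𝕂[fun e => if e ∈ F then 0 else w e](S, T₀) := by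
  have he : s(y, z) ∉ (∅ : Set (Sym2 V)) := fun h => h
  have hFe : insert s(y, z) (∅ : Set (Sym2 V)) = F := by rw [hF]; exact (Set.singleton_def _).symm
  have hzero : ∀ t, t ≠ y → (fun e : Sym2 V => if e ∈ F then (0 : unitInterval) else w e) s(y, t) = 0 := by
    intro t hty
    show (if s(y, t) ∈ F then (0 : unitInterval) else w s(y, t)) = 0
    split_ifs with h
    · rfl
    · have htz : t ≠ z := fun htz => h (by rw [htz, hF]; rfl)
      exact hpend t hty htz
  have fin : ∀ T' : Set V, 𝔸[w](insert s(y, z) (∅ : Set (Sym2 V)), S, insert y T') =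
      𝕂[fun e : Sym2 V => if e ∈ F then (0 : unitInterval) else w e](S, T') := by
    intro T'
    rw [avoidSdiff_eq_kernel, hFe]
    exact real_avoid_insert_of_isolated (fun e : Sym2 V => if e ∈ F then (0 : unitInterval) else w e) S T' hyS hzero
  rw [← avoidSdiff_empty w S (insert y T₀), avoidSdiff_pivot' w ∅ S T₀ hyz he, fin, fin]

omit [Fintype V] in
/-- The `3 × 3` determinant with a column of ones, written out. [folklore] -/
private theorem det3_oneCol (b c e f h i : ℝ) :
    Matrix.det !![(1 : ℝ), b, c; 1, e, f; 1, h, i] = e * i - f * h - b * i + b * f + c * h - c * e := by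
  rw [Matrix.det_fin_three]
  simp only [Matrix.of_apply, Matrix.cons_val', Matrix.cons_val_zero, Matrix.cons_val_one,
    Matrix.cons_val_two, Matrix.empty_val', Matrix.cons_val_fin_one, Matrix.head_cons, Matrix.head_fin_const,
    Matrix.tail_cons]
  ring

/-- **THEOREM (set-target `D₀`): for target sets `O ⊆ O'` and all `x, u, v`,
`0 ≤ det[[1,K(x,O'),K(x,O∪v)],[1,K(xu,O'),K(xu,O∪v)],[1,K(xuv,O'),K(xuv,O∪v)]]`**, i.e.
`K(x,Ov)·[K(xu,O') − K(xuv,O')] ≤ K(xu,Ov)·[K(x,O') − K(xuv,O')]` (`K(xuv,Ov) = 0`).  In words: given `x ↮ O∪v`, the probability that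
`u` also avoids `O∪v` times ... — the source `v` reaches the bigger set `O'` while `x,u` do not, compared between the worlds
`{x ↮ O'}` and `{xu ↮ O'}`.  vdBHK Thm 1.3 for the source set `O'∪{v}` given `O'∪v ↮ x` + containment + `RR₂`.  The case
`O = O' = {o}` is `Consts.chainRule_voAvoid_noTarget` (`D₀`); `O = {o} ⊂ O' = {o,z}` is the piece `d₂` and `O = O' = {o,z}` the piece
`d₂₃` of the pendant peel below. [cite: VandenbergHaggstromKahn2005, Thm. 1.3 (p. 6) with Remark 1 after Thm. 1.2 (p. 5), Thm. 1.5 (p. 7)] -/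
theorem chainMinor_midSetTarget_noAvoid (w : Sym2 V → unitInterval) (x u v : V) {O O' : Set V} (hOO' : O ⊆ O') :
    0 ≤ Matrix.det !![
      (1 : ℝ), 𝕂[w](({x} : Set V), O'), 𝕂[w](({x} : Set V), insert v O);
      1, 𝕂[w](({x, u} : Set V), O'), 𝕂[w](({x, u} : Set V), insert v O);
      1, 𝕂[w](({x, u, v} : Set V), O'), 𝕂[w](({x, u, v} : Set V), insert v O)] := by
  classical
  set μ := prodBernoulli w with hμ
  have hmeas : ∀ T : Set (BondConfig V), MeasurableSet T := fun _ => MeasurableSet.of_discrete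
  -- names
  set p := 𝕂[w](({x} : Set V), insert v O) with hp
  set s := 𝕂[w](({x, u} : Set V), insert v O) with hs
  set p' := 𝕂[w](({x} : Set V), insert v O') with hp'
  set s' := 𝕂[w](({x, u} : Set V), insert v O') with hs'
  set c := 𝕂[w](({x} : Set V), O') with hc
  set t := 𝕂[w](({x, u} : Set V), O') with ht
  set zz := 𝕂[w](({x, u, v} : Set V), O') with hzz
  have hK3 : 𝕂[w](({x, u, v} : Set V), insert v O) = 0 :=
    real_avoid_eq_zero_of_mem w (show v ∈ ({x, u, v} : Set V) by simp) (mem_insert v O)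
  -- the events of the set source `O' ∪ {v}` avoiding `x`
  set Sv : Set V := insert v O' with hSv
  set D : Set (BondConfig V) := {ω | ∀ s₁ ∈ Sv, ∀ t₁ ∈ ({x} : Set V), ¬ (openGraph ω).Reachable s₁ t₁} with hD
  set W : Set (BondConfig V) := {ω | ∃ s₁ ∈ ({v} : Set V), ∃ a ∈ O', (openGraph ω).Reachable s₁ a} with hW
  set U : Set (BondConfig V) := {ω | ∃ s₁ ∈ Sv, ∃ a ∈ ({u} : Set V), (openGraph ω).Reachable s₁ a} with hU
  have key := real_avoid_conn_notConn_mul_le w Sv ({x} : Set V) (S₁ := {v}) (S₂ := Sv)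
    (singleton_subset_iff.2 (mem_insert v O')) subset_rfl O' ({u} : Set V)
  change μ.real (D ∩ W ∩ Uᶜ) * μ.real D ≤ μ.real (D ∩ W) * μ.real (D ∩ Uᶜ) at key
  -- identify `μ(D) = p'`, `μ(D ∩ Uᶜ) = s'`, `μ(D ∩ W ∩ Uᶜ) = t − zz`, `μ(D ∩ W) ≤ c − zz`
  have hDp : μ.real D = p' := by rw [hp', hD, setOf_avoid_comm]
  have hDU : D ∩ Uᶜ = {ω : BondConfig V | ∀ s₁ ∈ ({x, u} : Set V), ∀ t₁ ∈ Sv, ¬ (openGraph ω).Reachable s₁ t₁} := by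
    ext ω
    constructor
    · rintro ⟨h1, h2⟩ s₁ hs₁ t₁ ht₁ hr
      rcases mem_insert_iff.1 hs₁ with h | h
      · rw [h] at hr
        exact h1 t₁ ht₁ x (mem_singleton x) hr.symm
      · rw [mem_singleton_iff.1 h] at hr
        exact h2 ⟨t₁, ht₁, u, mem_singleton u, hr.symm⟩
    · intro h
      refine ⟨fun s₁ hs₁ t₁ ht₁ hr => ?_, fun ⟨s₁, hs₁, a, ha, hr⟩ => ?_⟩
      · rw [mem_singleton_iff.1 ht₁] at hr
        exact h x (mem_insert _ _) s₁ hs₁ hr.symm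
      · rw [mem_singleton_iff.1 ha] at hr
        exact h u (mem_insert_of_mem _ (mem_singleton u)) s₁ hs₁ hr.symm
  have hDUs : μ.real (D ∩ Uᶜ) = s' := by rw [hDU]
  have hsub32 : {ω : BondConfig V | ∀ s₁ ∈ ({x, u, v} : Set V), ∀ t₁ ∈ O', ¬ (openGraph ω).Reachable s₁ t₁} ⊆
      {ω : BondConfig V | ∀ s₁ ∈ ({x, u} : Set V), ∀ t₁ ∈ O', ¬ (openGraph ω).Reachable s₁ t₁} := by
    intro ω h s₁ hs₁ t₁ ht₁
    exact h s₁ (by simp only [mem_insert_iff, mem_singleton_iff] at hs₁ ⊢; tauto) t₁ ht₁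
  have hsub31 : {ω : BondConfig V | ∀ s₁ ∈ ({x, u, v} : Set V), ∀ t₁ ∈ O', ¬ (openGraph ω).Reachable s₁ t₁} ⊆
      {ω : BondConfig V | ∀ s₁ ∈ ({x} : Set V), ∀ t₁ ∈ O', ¬ (openGraph ω).Reachable s₁ t₁} := by
    intro ω h s₁ hs₁ t₁ ht₁
    exact h s₁ (by simp only [mem_insert_iff, mem_singleton_iff] at hs₁ ⊢; tauto) t₁ ht₁
  have hvS3 : v ∈ ({x, u, v} : Set V) := by simp
  have hDWU : {ω : BondConfig V | ∀ s₁ ∈ ({x, u} : Set V), ∀ t₁ ∈ O', ¬ (openGraph ω).Reachable s₁ t₁} \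
      {ω : BondConfig V | ∀ s₁ ∈ ({x, u, v} : Set V), ∀ t₁ ∈ O', ¬ (openGraph ω).Reachable s₁ t₁} = D ∩ W ∩ Uᶜ := by
    ext ω
    constructor
    · rintro ⟨h2, h3⟩
      have hx : ∀ t₁ ∈ O', ¬ (openGraph ω).Reachable x t₁ := h2 x (mem_insert _ _)
      have hu : ∀ t₁ ∈ O', ¬ (openGraph ω).Reachable u t₁ := h2 u (mem_insert_of_mem _ (mem_singleton u))
      obtain ⟨a, ha, hva⟩ : ∃ a ∈ O', (openGraph ω).Reachable v a := by
        by_contra hcon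
        apply h3
        intro s₁ hs₁ t₁ ht₁
        rcases mem_insert_iff.1 hs₁ with h | h
        · rw [h]; exact hx t₁ ht₁
        rcases mem_insert_iff.1 h with h' | h'
        · rw [h']; exact hu t₁ ht₁
        · rw [mem_singleton_iff.1 h']; exact fun hr => hcon ⟨t₁, ht₁, hr⟩
      refine ⟨⟨?_, ?_⟩, ?_⟩
      · intro s₁ hs₁ t₁ ht₁ hr
        rw [mem_singleton_iff.1 ht₁] at hr
        rcases mem_insert_iff.1 hs₁ with h | h
        · rw [h] at hr; exact hx a ha (hr.symm.trans hva)
        · exact hx s₁ h hr.symm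
      · exact ⟨v, mem_singleton v, a, ha, hva⟩
      · rintro ⟨s₁, hs₁, b, hb, hr⟩
        rw [mem_singleton_iff.1 hb] at hr
        rcases mem_insert_iff.1 hs₁ with h | h
        · rw [h] at hr; exact hu a ha (hr.symm.trans hva)
        · exact hu s₁ h hr.symm
    · rintro ⟨⟨hDω, ⟨s₁, hs₁, a, ha, hva⟩⟩, hUω⟩
      rw [mem_singleton_iff.1 hs₁] at hva
      refine ⟨?_, ?_⟩
      · intro s₂ hs₂ t₁ ht₁ hr
        rcases mem_insert_iff.1 hs₂ with h | h
        · rw [h] at hr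
          exact hDω t₁ (mem_insert_of_mem _ ht₁) x (mem_singleton x) hr.symm
        · rw [mem_singleton_iff.1 h] at hr
          exact hUω ⟨t₁, mem_insert_of_mem _ ht₁, u, mem_singleton u, hr.symm⟩
      · intro h3
        exact h3 v hvS3 a ha hva
  have hDWUr : μ.real (D ∩ W ∩ Uᶜ) = t - zz := by
    rw [ht, hzz, ← measureReal_sdiff hsub32 (hmeas _), hDWU]
  have hDW : μ.real (D ∩ W) ≤ c - zz := by
    have hsub2 : D ∩ W ⊆ {ω : BondConfig V | ∀ s₁ ∈ ({x} : Set V), ∀ t₁ ∈ O', ¬ (openGraph ω).Reachable s₁ t₁} \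
        {ω : BondConfig V | ∀ s₁ ∈ ({x, u, v} : Set V), ∀ t₁ ∈ O', ¬ (openGraph ω).Reachable s₁ t₁} := by
      rintro ω ⟨hDω, ⟨s₁, hs₁, a, ha, hva⟩⟩
      rw [mem_singleton_iff.1 hs₁] at hva
      refine ⟨fun s₂ hs₂ t₁ ht₁ hr => ?_, fun h3 => h3 v hvS3 a ha hva⟩
      rw [mem_singleton_iff.1 hs₂] at hr
      exact hDω t₁ (mem_insert_of_mem _ ht₁) x (mem_singleton x) hr.symm
    rw [hc, hzz, ← measureReal_sdiff hsub31 (hmeas _)]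
    exact measureReal_mono hsub2
  -- vdBHK in the form `p' (t − zz) ≤ (c − zz) s'`
  have htz0 : 0 ≤ t - zz := by rw [← hDWUr]; exact measureReal_nonneg
  have htzp : t - zz ≤ p' := by rw [← hDWUr, ← hDp]; exact measureReal_mono (fun ω h => h.1.1)
  have hs'0 : 0 ≤ s' := measureReal_nonneg
  have hineq : p' * (t - zz) ≤ (c - zz) * s' := by
    rw [← hDp, ← hDWUr, ← hDUs]
    calc μ.real D * μ.real (D ∩ W ∩ Uᶜ) = μ.real (D ∩ W ∩ Uᶜ) * μ.real D := mul_comm _ _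
      _ ≤ μ.real (D ∩ W) * μ.real (D ∩ Uᶜ) := key
      _ ≤ (c - zz) * μ.real (D ∩ Uᶜ) := mul_le_mul_of_nonneg_right hDW measureReal_nonneg
  -- reverse regularity `p s' ≤ p' s`
  have hrr : p * s' ≤ p' * s :=
    disconnect_rr2 w (show ({x} : Set V) ⊆ ({x, u} : Set V) from singleton_subset_iff.2 (mem_insert _ _))
      (insert_subset_insert hOO')
  have hp0 : 0 ≤ p := measureReal_nonneg
  have hs0 : 0 ≤ s := measureReal_nonneg
  have hczz : 0 ≤ c - zz := le_trans measureReal_nonneg hDW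
  have hdet : Matrix.det !![(1 : ℝ), c, p; 1, t, s; 1, zz, 𝕂[w](({x, u, v} : Set V), insert v O)] = s * (c - zz) - p * (t - zz) := by
    rw [det3_oneCol, hK3]; ring
  rw [hdet]
  rcases eq_or_lt_of_le (show 0 ≤ p' from measureReal_nonneg) with hp'0 | hp'pos
  · have htz : t - zz = 0 := le_antisymm (by rw [hp'0]; exact htzp) htz0
    rw [htz, mul_zero, sub_zero]; exact mul_nonneg hs0 hczz
  · -- multiply through by `p' > 0`
    have h1 : p' * (p * (t - zz)) ≤ p' * (s * (c - zz)) := by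
      calc p' * (p * (t - zz)) = p * (p' * (t - zz)) := by ring
        _ ≤ p * ((c - zz) * s') := mul_le_mul_of_nonneg_left hineq hp0
        _ = (c - zz) * (p * s') := by ring
        _ ≤ (c - zz) * (p' * s) := mul_le_mul_of_nonneg_left hrr hczz
        _ = p' * (s * (c - zz)) := by ring
    nlinarith [le_of_mul_le_mul_left h1 hp'pos]

/-- **The one-edge Bernstein form of the chain minor at an avoided vertex pendant at `z`.**  With `q = w(s(y,z))`, all other pairs at `y`
of weight `0`, and `k` the kernel of `w` switched off at `s(y,z)`:
`D(G;{y}) = (1−q)³·D₀ + q(1−q)²·(d₁+d₂+d₃) + q²(1−q)·(d₁₂+d₁₃+d₂₃) + q³·D(G⁰;{z})`, `d_J` = the determinant with `z` adjoined to the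
targets of the columns in `J` (columns `(∅, o, ov)`; the first column of `d_∅ = D₀`, `d₂`, `d₃`, `d₂₃` is a column of ones).
[cite: VandenbergHaggstromKahn2005, Thm. 1.1 proof (pp. 4–5)] -/
theorem chainMinor_pendant_eq (w : Sym2 V → unitInterval) (x u v o y z : V)
    (hyx : y ≠ x) (hyu : y ≠ u) (hyv : y ≠ v) (hyz : y ≠ z) (hpend : ∀ t, t ≠ y → t ≠ z → w s(y, t) = 0)
    (F : Set (Sym2 V)) (hF : F = {s(y, z)}) (wF : Sym2 V → unitInterval) (hwF : wF = fun e => if e ∈ F then 0 else w e) :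
    Matrix.det !![
      𝕂[w](({x} : Set V), ({y} : Set V)), 𝕂[w](({x} : Set V), insert o ({y} : Set V)), 𝕂[w](({x} : Set V), insert v (insert o ({y} : Set V)));
      𝕂[w](({x, u} : Set V), ({y} : Set V)), 𝕂[w](({x, u} : Set V), insert o ({y} : Set V)), 𝕂[w](({x, u} : Set V), insert v (insert o ({y} : Set V)));
      𝕂[w](({x, u, v} : Set V), ({y} : Set V)), 𝕂[w](({x, u, v} : Set V), insert o ({y} : Set V)),
        𝕂[w](({x, u, v} : Set V), insert v (insert o ({y} : Set V)))] =
    (1 - (w s(y, z) : ℝ)) ^ 3 * Matrix.det !![(1 : ℝ), 𝕂[wF](({x} : Set V), ({o} : Set V)), 𝕂[wF](({x} : Set V), ({v, o} : Set V));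
        (1 : ℝ), 𝕂[wF](({x, u} : Set V), ({o} : Set V)), 𝕂[wF](({x, u} : Set V), ({v, o} : Set V));
        (1 : ℝ), 𝕂[wF](({x, u, v} : Set V), ({o} : Set V)), 𝕂[wF](({x, u, v} : Set V), ({v, o} : Set V))] +
      (w s(y, z) : ℝ) * (1 - (w s(y, z) : ℝ)) ^ 2 *
        (Matrix.det !![𝕂[wF](({x} : Set V), ({z} : Set V)), 𝕂[wF](({x} : Set V), ({o} : Set V)), 𝕂[wF](({x} : Set V), ({v, o} : Set V));
        𝕂[wF](({x, u} : Set V), ({z} : Set V)), 𝕂[wF](({x, u} : Set V), ({o} : Set V)), 𝕂[wF](({x, u} : Set V), ({v, o} : Set V));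
        𝕂[wF](({x, u, v} : Set V), ({z} : Set V)), 𝕂[wF](({x, u, v} : Set V), ({o} : Set V)), 𝕂[wF](({x, u, v} : Set V), ({v, o} : Set V))] +
         Matrix.det !![(1 : ℝ), 𝕂[wF](({x} : Set V), ({o, z} : Set V)), 𝕂[wF](({x} : Set V), ({v, o} : Set V));
        (1 : ℝ), 𝕂[wF](({x, u} : Set V), ({o, z} : Set V)), 𝕂[wF](({x, u} : Set V), ({v, o} : Set V));
        (1 : ℝ), 𝕂[wF](({x, u, v} : Set V), ({o, z} : Set V)), 𝕂[wF](({x, u, v} : Set V), ({v, o} : Set V))] +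
         Matrix.det !![(1 : ℝ), 𝕂[wF](({x} : Set V), ({o} : Set V)), 𝕂[wF](({x} : Set V), ({v, o, z} : Set V));
        (1 : ℝ), 𝕂[wF](({x, u} : Set V), ({o} : Set V)), 𝕂[wF](({x, u} : Set V), ({v, o, z} : Set V));
        (1 : ℝ), 𝕂[wF](({x, u, v} : Set V), ({o} : Set V)), 𝕂[wF](({x, u, v} : Set V), ({v, o, z} : Set V))]) +
      (w s(y, z) : ℝ) ^ 2 * (1 - (w s(y, z) : ℝ)) *
        (Matrix.det !![𝕂[wF](({x} : Set V), ({z} : Set V)), 𝕂[wF](({x} : Set V), ({o, z} : Set V)), 𝕂[wF](({x} : Set V), ({v, o} : Set V));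
        𝕂[wF](({x, u} : Set V), ({z} : Set V)), 𝕂[wF](({x, u} : Set V), ({o, z} : Set V)), 𝕂[wF](({x, u} : Set V), ({v, o} : Set V));
        𝕂[wF](({x, u, v} : Set V), ({z} : Set V)), 𝕂[wF](({x, u, v} : Set V), ({o, z} : Set V)), 𝕂[wF](({x, u, v} : Set V), ({v, o} : Set V))] +
         Matrix.det !![𝕂[wF](({x} : Set V), ({z} : Set V)), 𝕂[wF](({x} : Set V), ({o} : Set V)), 𝕂[wF](({x} : Set V), ({v, o, z} : Set V));
        𝕂[wF](({x, u} : Set V), ({z} : Set V)), 𝕂[wF](({x, u} : Set V), ({o} : Set V)), 𝕂[wF](({x, u} : Set V), ({v, o, z} : Set V));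
        𝕂[wF](({x, u, v} : Set V), ({z} : Set V)), 𝕂[wF](({x, u, v} : Set V), ({o} : Set V)), 𝕂[wF](({x, u, v} : Set V), ({v, o, z} : Set V))] +
         Matrix.det !![(1 : ℝ), 𝕂[wF](({x} : Set V), ({o, z} : Set V)), 𝕂[wF](({x} : Set V), ({v, o, z} : Set V));
        (1 : ℝ), 𝕂[wF](({x, u} : Set V), ({o, z} : Set V)), 𝕂[wF](({x, u} : Set V), ({v, o, z} : Set V));
        (1 : ℝ), 𝕂[wF](({x, u, v} : Set V), ({o, z} : Set V)), 𝕂[wF](({x, u, v} : Set V), ({v, o, z} : Set V))]) +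
      (w s(y, z) : ℝ) ^ 3 * Matrix.det !![𝕂[wF](({x} : Set V), ({z} : Set V)), 𝕂[wF](({x} : Set V), ({o, z} : Set V)), 𝕂[wF](({x} : Set V), ({v, o, z} : Set V));
        𝕂[wF](({x, u} : Set V), ({z} : Set V)), 𝕂[wF](({x, u} : Set V), ({o, z} : Set V)), 𝕂[wF](({x, u} : Set V), ({v, o, z} : Set V));
        𝕂[wF](({x, u, v} : Set V), ({z} : Set V)), 𝕂[wF](({x, u, v} : Set V), ({o, z} : Set V)), 𝕂[wF](({x, u, v} : Set V), ({v, o, z} : Set V))] := by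
  -- normalise the targets to `insert y T₀`
  have h3 : (insert v (insert o ({y} : Set V)) : Set V) = insert y (insert v ({o} : Set V)) := by
    ext a; simp only [mem_insert_iff, mem_singleton_iff]; tauto
  have h2 : (insert o ({y} : Set V) : Set V) = insert y ({o} : Set V) := Set.pair_comm _ _
  have h1 : ({y} : Set V) = insert y (∅ : Set V) := Set.singleton_def y
  rw [h3, h2, h1]
  have hy1 : y ∉ ({x} : Set V) := fun h => hyx (mem_singleton_iff.1 h)
  have hy2 : y ∉ ({x, u} : Set V) := by simp only [mem_insert_iff, mem_singleton_iff, not_or]; exact ⟨hyx, hyu⟩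
  have hy3 : y ∉ ({x, u, v} : Set V) := by simp only [mem_insert_iff, mem_singleton_iff, not_or]; exact ⟨hyx, hyu, hyv⟩
  have P := fun (S : Set V) (hyS : y ∉ S) (T₀ : Set V) => real_avoid_insert_pendant w S T₀ hyz hyS hpend F hF
  rw [P _ hy1 ∅, P _ hy1 {o}, P _ hy1 (insert v {o}), P _ hy2 ∅, P _ hy2 {o}, P _ hy2 (insert v {o}),
    P _ hy3 ∅, P _ hy3 {o}, P _ hy3 (insert v {o})]
  rw [← hwF]
  -- set normalisations
  have e1 : (insert z (∅ : Set V)) = ({z} : Set V) := (Set.singleton_def z).symm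
  have e2 : (insert z ({o} : Set V)) = ({o, z} : Set V) := Set.pair_comm _ _
  have e3 : (insert z (insert v ({o} : Set V))) = ({v, o, z} : Set V) := by
    ext a; simp only [mem_insert_iff, mem_singleton_iff]; tauto
  have one0 : 𝕂[wF](({x} : Set V), (∅ : Set V)) = 1 := real_avoid_emptyTarget wF _
  have one1 : 𝕂[wF](({x, u} : Set V), (∅ : Set V)) = 1 := real_avoid_emptyTarget wF _
  have one2 : 𝕂[wF](({x, u, v} : Set V), (∅ : Set V)) = 1 := real_avoid_emptyTarget wF _
  simp only [e1, e2, e3, one0, one1, one2]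
  simp only [Matrix.det_fin_three, Matrix.of_apply, Matrix.cons_val', Matrix.cons_val_zero, Matrix.cons_val_one,
    Matrix.cons_val_two, Matrix.empty_val', Matrix.cons_val_fin_one, Matrix.head_cons, Matrix.head_fin_const,
    Matrix.tail_cons]
  ring

/-- **COROLLARY — the chain minor for an avoided vertex pendant at `z` is nonnegative as soon as the two avoided-set-free
coefficients `M₁ = d₁+d₂+d₃`, `M₂ = d₁₂+d₁₃+d₂₃` and the chain minor `D(G⁰;{z})` of the switched-off graph are** (`D₀ ≥ 0` is
`Consts.chainMinor_midSetTarget_noAvoid` at `O = O' = {o}`).  This is the `Y`-edge interpolation step of the peel programme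
(memo §2): the whole conjecture reduces this way to avoided-set-free profile sums. [cite: VandenbergHaggstromKahn2005, Thm. 1.3 (p. 6)] -/
theorem chainMinor_pendant_nonneg_of (w : Sym2 V → unitInterval) (x u v o y z : V)
    (hyx : y ≠ x) (hyu : y ≠ u) (hyv : y ≠ v) (hyz : y ≠ z) (hpend : ∀ t, t ≠ y → t ≠ z → w s(y, t) = 0)
    (F : Set (Sym2 V)) (hF : F = {s(y, z)}) (wF : Sym2 V → unitInterval) (hwF : wF = fun e => if e ∈ F then 0 else w e)
    (hM₁ : 0 ≤ Matrix.det !![𝕂[wF](({x} : Set V), ({z} : Set V)), 𝕂[wF](({x} : Set V), ({o} : Set V)), 𝕂[wF](({x} : Set V), ({v, o} : Set V));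
        𝕂[wF](({x, u} : Set V), ({z} : Set V)), 𝕂[wF](({x, u} : Set V), ({o} : Set V)), 𝕂[wF](({x, u} : Set V), ({v, o} : Set V));
        𝕂[wF](({x, u, v} : Set V), ({z} : Set V)), 𝕂[wF](({x, u, v} : Set V), ({o} : Set V)), 𝕂[wF](({x, u, v} : Set V), ({v, o} : Set V))] +
         Matrix.det !![(1 : ℝ), 𝕂[wF](({x} : Set V), ({o, z} : Set V)), 𝕂[wF](({x} : Set V), ({v, o} : Set V));
        (1 : ℝ), 𝕂[wF](({x, u} : Set V), ({o, z} : Set V)), 𝕂[wF](({x, u} : Set V), ({v, o} : Set V));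
        (1 : ℝ), 𝕂[wF](({x, u, v} : Set V), ({o, z} : Set V)), 𝕂[wF](({x, u, v} : Set V), ({v, o} : Set V))] +
         Matrix.det !![(1 : ℝ), 𝕂[wF](({x} : Set V), ({o} : Set V)), 𝕂[wF](({x} : Set V), ({v, o, z} : Set V));
        (1 : ℝ), 𝕂[wF](({x, u} : Set V), ({o} : Set V)), 𝕂[wF](({x, u} : Set V), ({v, o, z} : Set V));
        (1 : ℝ), 𝕂[wF](({x, u, v} : Set V), ({o} : Set V)), 𝕂[wF](({x, u, v} : Set V), ({v, o, z} : Set V))])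
    (hM₂ : 0 ≤ Matrix.det !![𝕂[wF](({x} : Set V), ({z} : Set V)), 𝕂[wF](({x} : Set V), ({o, z} : Set V)), 𝕂[wF](({x} : Set V), ({v, o} : Set V));
        𝕂[wF](({x, u} : Set V), ({z} : Set V)), 𝕂[wF](({x, u} : Set V), ({o, z} : Set V)), 𝕂[wF](({x, u} : Set V), ({v, o} : Set V));
        𝕂[wF](({x, u, v} : Set V), ({z} : Set V)), 𝕂[wF](({x, u, v} : Set V), ({o, z} : Set V)), 𝕂[wF](({x, u, v} : Set V), ({v, o} : Set V))] +
         Matrix.det !![𝕂[wF](({x} : Set V), ({z} : Set V)), 𝕂[wF](({x} : Set V), ({o} : Set V)), 𝕂[wF](({x} : Set V), ({v, o, z} : Set V));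
        𝕂[wF](({x, u} : Set V), ({z} : Set V)), 𝕂[wF](({x, u} : Set V), ({o} : Set V)), 𝕂[wF](({x, u} : Set V), ({v, o, z} : Set V));
        𝕂[wF](({x, u, v} : Set V), ({z} : Set V)), 𝕂[wF](({x, u, v} : Set V), ({o} : Set V)), 𝕂[wF](({x, u, v} : Set V), ({v, o, z} : Set V))] +
         Matrix.det !![(1 : ℝ), 𝕂[wF](({x} : Set V), ({o, z} : Set V)), 𝕂[wF](({x} : Set V), ({v, o, z} : Set V));
        (1 : ℝ), 𝕂[wF](({x, u} : Set V), ({o, z} : Set V)), 𝕂[wF](({x, u} : Set V), ({v, o, z} : Set V));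
        (1 : ℝ), 𝕂[wF](({x, u, v} : Set V), ({o, z} : Set V)), 𝕂[wF](({x, u, v} : Set V), ({v, o, z} : Set V))])
    (hDz : 0 ≤ Matrix.det !![𝕂[wF](({x} : Set V), ({z} : Set V)), 𝕂[wF](({x} : Set V), ({o, z} : Set V)), 𝕂[wF](({x} : Set V), ({v, o, z} : Set V));
        𝕂[wF](({x, u} : Set V), ({z} : Set V)), 𝕂[wF](({x, u} : Set V), ({o, z} : Set V)), 𝕂[wF](({x, u} : Set V), ({v, o, z} : Set V));
        𝕂[wF](({x, u, v} : Set V), ({z} : Set V)), 𝕂[wF](({x, u, v} : Set V), ({o, z} : Set V)), 𝕂[wF](({x, u, v} : Set V), ({v, o, z} : Set V))]) :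
    0 ≤ Matrix.det !![
      𝕂[w](({x} : Set V), ({y} : Set V)), 𝕂[w](({x} : Set V), insert o ({y} : Set V)), 𝕂[w](({x} : Set V), insert v (insert o ({y} : Set V)));
      𝕂[w](({x, u} : Set V), ({y} : Set V)), 𝕂[w](({x, u} : Set V), insert o ({y} : Set V)), 𝕂[w](({x, u} : Set V), insert v (insert o ({y} : Set V)));
      𝕂[w](({x, u, v} : Set V), ({y} : Set V)), 𝕂[w](({x, u, v} : Set V), insert o ({y} : Set V)),
        𝕂[w](({x, u, v} : Set V), insert v (insert o ({y} : Set V)))] := by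
  rw [chainMinor_pendant_eq w x u v o y z hyx hyu hyv hyz hpend F hF wF hwF]
  have hD0 : 0 ≤ Matrix.det !![(1 : ℝ), 𝕂[wF](({x} : Set V), ({o} : Set V)), 𝕂[wF](({x} : Set V), ({v, o} : Set V));
        (1 : ℝ), 𝕂[wF](({x, u} : Set V), ({o} : Set V)), 𝕂[wF](({x, u} : Set V), ({v, o} : Set V));
        (1 : ℝ), 𝕂[wF](({x, u, v} : Set V), ({o} : Set V)), 𝕂[wF](({x, u, v} : Set V), ({v, o} : Set V))] :=
    chainMinor_midSetTarget_noAvoid wF x u v (subset_refl ({o} : Set V))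
  have hq0 : 0 ≤ (w s(y, z) : ℝ) := (w s(y, z)).2.1
  have hq1 : 0 ≤ 1 - (w s(y, z) : ℝ) := by linarith [(w s(y, z)).2.2]
  have t1 := mul_nonneg (pow_nonneg hq1 3) hD0
  have t2 := mul_nonneg (mul_nonneg hq0 (pow_nonneg hq1 2)) hM₁
  have t3 := mul_nonneg (mul_nonneg (pow_nonneg hq0 2) hq1) hM₂
  have t4 := mul_nonneg (pow_nonneg hq0 3) hDz
  linarith

/-- **The pieces `d₂ ≥ 0` and `d₂₃ ≥ 0` of `M₁`, `M₂`** are instances of `Consts.chainMinor_midSetTarget_noAvoid`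
(`O = {o} ⊆ O' = {o,z}`, resp. `O = O' = {o,z}`); the remaining pieces `d₁, d₃` and `d₁₃` are two-signed, `d₁₂ ≥ 0` follows from
`D(G;{z}) ≥ 0` by `RR₂` (memo §3). [cite: VandenbergHaggstromKahn2005, Thm. 1.3 (p. 6)] -/
theorem chainMinor_pendant_d2_d23_nonneg (wF : Sym2 V → unitInterval) (x u v o z : V) :
    0 ≤ Matrix.det !![(1 : ℝ), 𝕂[wF](({x} : Set V), ({o, z} : Set V)), 𝕂[wF](({x} : Set V), ({v, o} : Set V));
        (1 : ℝ), 𝕂[wF](({x, u} : Set V), ({o, z} : Set V)), 𝕂[wF](({x, u} : Set V), ({v, o} : Set V));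
        (1 : ℝ), 𝕂[wF](({x, u, v} : Set V), ({o, z} : Set V)), 𝕂[wF](({x, u, v} : Set V), ({v, o} : Set V))] ∧
    0 ≤ Matrix.det !![(1 : ℝ), 𝕂[wF](({x} : Set V), ({o, z} : Set V)), 𝕂[wF](({x} : Set V), ({v, o, z} : Set V));
        (1 : ℝ), 𝕂[wF](({x, u} : Set V), ({o, z} : Set V)), 𝕂[wF](({x, u} : Set V), ({v, o, z} : Set V));
        (1 : ℝ), 𝕂[wF](({x, u, v} : Set V), ({o, z} : Set V)), 𝕂[wF](({x, u, v} : Set V), ({v, o, z} : Set V))] :=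
  ⟨chainMinor_midSetTarget_noAvoid wF x u v (show ({o} : Set V) ⊆ ({o, z} : Set V) from
      singleton_subset_iff.2 (mem_insert _ _)),
   chainMinor_midSetTarget_noAvoid wF x u v (subset_refl ({o, z} : Set V))⟩

end Consts

end Summit.CriticalPhenomena.PercolationContinuityZ3.Theorems

end
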